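/-
Origin: expansion seat `planner-pub-hodgecm-qw8-g11-0`, handover #3 REPLACE (DOC-ONLY) md5 3d04f6f51b4b60b378b4b30e887e65b2 (354 l.) SUPERSEDES tree `HodgeCM/Model/Toy/ToyGysinDescent.lean` bdc78593 (352 l.): docstrings added to every undocumented theorem/def (CONVENTIONS §3 debt → 0), comment-stripped code IDENTICAL to the tree copy (residue md5 af5173ca; no declaration, statement or proof changed); imports unchanged (HodgeCM.Model.Toy.ToyFFacts, HodgeCM.Model (`HOME/pub-hodgecm-qw8-g11/lean/Qw8g11/ToyGysinDescent.lean`, md5 3d04f6f5, 354 lines);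
landed by the packager successor (mc-unitary-1-g3, gen-8 kit) in gate run 32 REPLACES the earlier landed copy of `HodgeCM/Model/Toy/ToyGysinDescent.lean` (seat copy carried the packager origin header of the earlier run (stripped)).
-/
/-
pub-hodgecm cell (HodgeCMPerL) — QW8 lineage gen 4 (`planner-pub-hodgecm-qw8-g4-0`, unit `pub-hodgecm-qw8-g4`).
WIP module `Qw8g4.ToyGysinDescent`; intended final module `HodgeCM.Model.Toy.ToyGysinDescent` (kind L5: toy model /
consistency witness).  Its one WIP import `Qw8g4.GysinDescent` ↦ `HodgeCM.StubTree.Qw8GysinDescent`.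

# F7d `Fact_gysinDescent` HOLDS in the exterior CM-model — the [QW8] §2.5 input list is jointly witnessed

`HodgeCM/StubTree/Qw8GysinDescent.lean` replaces the trace-dependent inputs of the [QW8] Thm 2.5 cone (F6
`Fact_weightDual`, F7 (ii) and `Fact_trTop`/`Fact_trTopCM`, none of which has a model among the exterior toys:
`ToyFFacts.not_fact_weightDual`, toy2-g2 `ToyTrTop`/`ToyRetrace`) by ONE trace-free fact F7d `Fact_gysinDescent`:
for the block projections of `P = Y × Y'` and a nonzero rational top class `ω` of `Y'`,
(a) `p_Y^* e ∪ p_{Y'}^* ω = 0 ⇒ e = 0`, (b) `p_Y^* e ∪ p_{Y'}^* ω ∈ Alg(P) ⇒ e ∈ Alg(Y)`.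

THIS FILE proves F7d in `toyModel = toyModelWith exteriorHodgeData` (`H^k(X) = ⋀^k_ℚ L X`, `∪ = ∧`, `Alg^p(X)` = the
Hodge classes of the eigenbasis Hodge structure, `tr = 0`):

* `GysinWitness.fact_dimProd` — `Fact_dimProd` (any Hodge datum; CM-type fields have even degree);
* `GysinWitness.GG_map_le`, `GysinWitness.wedge_mem_GG`, `GysinWitness.top_mem_FF_GG` — the anti-holomorphic span
  `GG` is natural for Hodge maps (conjugate of `Obj.hodgeF_natural`), multiplicative, and a top form of `Y'` has
  Hodge type exactly `(d', d')`;
* **`fact_gysinDescent : toyModel.Fact_gysinDescent`**.  (a) in positive degree is the kernel theorem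
  `Universe.boxC_ne_zero_succ` (ModelAxioms + N1 + F5 + `Fact_dimProd`, all toy theorems); in degree `0` it is
  `H⁰ = ⋀⁰ L = ℚ · 1`, `1 ∧ z = z` and `Universe.pullC_top_ne_zero`.  (b): write `Θ(1 ⊗ e) = f + g` with
  `f ∈ FF^p`, `g ∈ GG^p` (`Obj.isCompl_FF_GG`); `p_Y^* f ∧ p_{Y'}^* ω ∈ FF^{p+d'}` and `p_Y^* g ∧ p_{Y'}^* ω ∈ GG^{p+d'}`,
  so if the sum is in `FF^{p+d'}` then `p_Y^* g ∧ p_{Y'}^* ω ∈ FF ∩ GG = 0`, hence `g = 0` by (a)_ℂ, i.e.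
  `Θ(1 ⊗ e) ∈ FF^p`: `e` is a Hodge class;
* `descentFacts_consistent` — ONE model of `ModelAxioms ∧ N1 ∧ N2 ∧ N3 ∧ N4 ∧ F4 ∧ F5 ∧ F7d ∧ Fact_dimProd`, the
  exact generic hypothesis list of `Universe.qw8Sufficiency_of_descentFacts` / `Assembly.COR_CM_of_descentFacts`
  (minus `RealisationExistsFace`, the route's own input): the [QW8] §2.5 cone is not vacuous.

No proof holes, no new axiom (`#print axioms` = the three standard ones).
-/
import Summits.HodgeConjecture.HodgeCM.Model.Toy.ToyFFacts
import Summits.HodgeConjecture.HodgeCM.Model.Toy.Toy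
import Summits.HodgeConjecture.HodgeCM.StubTree.Qw8GysinDescent

noncomputable section

open scoped TensorProduct
open exteriorPower Module
open Literature.AlgebraicGeometry.Motives
open Literature.AlgebraicGeometry.Motives.HodgeStructure (ofRat ofRat_apply mem_hodgeClasses_iff)

namespace HodgeCM.Toy

namespace GysinWitness

/-! ### 1. Dimension bookkeeping (any Hodge datum) -/

variable (D : HodgeData)

/-- `#Idx X = dim_ℚ L X` (the eigenbasis `eB` of `ℂ ⊗ L X`). -/
theorem card_Idx (X : Obj) : Fintype.card X.Idx = Module.finrank ℚ X.L := by
  haveI : Module.Free ℚ X.L := Module.Free.of_divisionRing ℚ _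
  rw [← Module.finrank_eq_card_basis X.eB, Module.finrank_baseChange]

/-- a product of CM-type atoms has even rank (conjugation is a bijection `Φ → Φᶜ`: `two_mul_nhol_univ`) -/
theorem even_finrank_L (X : Obj) : Even (Module.finrank ℚ X.L) :=
  ⟨X.nhol Finset.univ, by rw [← card_Idx, ← two_mul_nhol_univ X, two_mul]⟩

/-- **`Fact_dimProd` in the exterior model** (any Hodge datum): `L (X × Y) = L X ⊕ L Y` with even summands. -/
theorem fact_dimProd : (toyModelWith D).Fact_dimProd := by
  intro X Y
  show Module.finrank ℚ (X.prod Y).L / 2 + (X.extra + Y.extra) =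
    Module.finrank ℚ X.L / 2 + X.extra + (Module.finrank ℚ Y.L / 2 + Y.extra)
  haveI : Module.Free ℚ X.L := Module.Free.of_divisionRing ℚ _
  haveI : Module.Free ℚ Y.L := Module.Free.of_divisionRing ℚ _
  rw [(X.sumEquiv Y).finrank_eq, Module.finrank_prod]
  obtain ⟨a, ha⟩ := even_finrank_L X
  obtain ⟨b, hb⟩ := even_finrank_L Y
  rw [ha, hb]
  omega

/-! ### 2. Top forms; the anti-holomorphic span `GG` is natural and multiplicative (any object) -/

/-- a form of top degree `k = #Idx X` lies in `FF k (nhol univ)` and in `GG k (nhol univ + 1)`: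
every injective top eigen-monomial uses all indices, so has exactly `nhol univ` holomorphic slots -/
theorem top_mem_FF_GG (X : Obj) {k : ℕ} (hk : Fintype.card X.Idx = k) (z : ⋀[ℂ]^k X.LC) :
    z ∈ X.FF k (X.nhol Finset.univ) ∧ z ∈ X.GG k ((X.nhol Finset.univ : ℤ) + 1) := by
  have hz : z ∈ Submodule.span ℂ (Set.range (X.mono k)) := by
    rw [X.span_mono_eq_top]; exact Submodule.mem_top
  refine ⟨(Submodule.span_le.mpr ?_) hz, (Submodule.span_le.mpr ?_) hz⟩
  · rintro _ ⟨g, rfl⟩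
    by_cases hg : Function.Injective g
    · exact X.mono_mem_FF (by rw [cnt_eq_nhol_univ g hg hk])
    · rw [X.mono_eq_zero_of_not_injective hg]; exact Submodule.zero_mem _
  · rintro _ ⟨g, rfl⟩
    by_cases hg : Function.Injective g
    · exact X.mono_mem_GG (by rw [cnt_eq_nhol_univ g hg hk]; exact Int.lt_succ _)
    · rw [X.mono_eq_zero_of_not_injective hg]; exact Submodule.zero_mem _

/-- **`GG` is natural for Hodge maps** — the complex conjugate of the `FF`-naturality `Obj.hodgeF_natural`
(`conj Θ⁻¹FF^q = Θ⁻¹GG^p`, `p + q = k + 1`, and a rational map commutes with `conj`). -/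
theorem GG_map_le {X Y : Obj} (f : Obj.Hom X Y) (k : ℕ) (p : ℤ) :
    (Y.GG k p).map (exteriorPower.map k (f.lin.baseChange ℂ)) ≤ X.GG k p := by
  rintro _ ⟨y, hy, rfl⟩
  obtain ⟨z, rfl⟩ : ∃ z, Y.Θ k z = y := ⟨(Y.Θ k).symm y, LinearEquiv.apply_symm_apply _ _⟩
  have hq : p + ((k : ℤ) + 1 - p) = k + 1 := by ring
  have hz : z ∈ HodgeStructure.complexConj (Y.hodgeF k ((k : ℤ) + 1 - p)) := by
    rw [Y.complexConj_hodgeF k p _ hq]; exact hy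
  have hfz : (exteriorPower.map k f.lin).baseChange ℂ z ∈
      HodgeStructure.complexConj (X.hodgeF k ((k : ℤ) + 1 - p)) := by
    rw [HodgeStructure.mem_complexConj, HodgeStructure.conj_baseChange]
    exact Obj.hodgeF_natural f k _ ⟨_, HodgeStructure.mem_complexConj.mp hz, rfl⟩
  rw [X.complexConj_hodgeF k p _ hq] at hfz
  have key : X.Θ k ((exteriorPower.map k f.lin).baseChange ℂ z) =
      exteriorPower.map k (f.lin.baseChange ℂ) (Y.Θ k z) := by
    rw [BC.thetaEquiv_apply, BC.thetaEquiv_apply, BC.theta_naturality]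
  have h3 : X.Θ k ((exteriorPower.map k f.lin).baseChange ℂ z) ∈ X.GG k p := hfz
  rwa [key] at h3

/-- **`GG ∧ GG ⊆ GG`**: `GG(k,p) ∧ GG(l,q) ⊆ GG(k+l, p+q-1)` (holomorphy counts of eigen-monomials add). -/
theorem wedge_mem_GG (X : Obj) (k l : ℕ) (p q : ℤ) {a : ⋀[ℂ]^k X.LC} {b : ⋀[ℂ]^l X.LC}
    (ha : a ∈ X.GG k p) (hb : b ∈ X.GG l q) : wedge ℂ X.LC k l a b ∈ X.GG (k + l) (p + q - 1) := by
  have h := Submodule.apply_mem_map₂ (wedge ℂ X.LC k l) ha hb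
  rw [Obj.GG, Obj.GG, Submodule.map₂_span_span] at h
  refine (Submodule.span_le.mpr ?_) h
  rintro _ ⟨x, ⟨g, hg, rfl⟩, y, ⟨g', hg', rfl⟩, rfl⟩
  show wedge ℂ X.LC k l (X.mono k g) (X.mono l g') ∈ X.GG (k + l) (p + q - 1)
  rw [X.wedge_mono]
  exact X.mono_mem_GG (by rw [X.cnt_append]; push_cast; omega)

/-! ### 3. The exterior CM-model: `Θ` and pull-backs, `2 dim A′ = #Idx A′ = 2 nhol(univ)` -/

/-- `Θ ∘ (f^*)_ℂ = ⋀^k f_ℂ ∘ Θ` -/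
theorem theta_pullC {X Y : Obj} (f : Obj.Hom X Y) (k : ℕ) (x : (toyModelWith D).CohC Y k) :
    X.Θ k ((toyModelWith D).pullC f k x) = exteriorPower.map k (f.lin.baseChange ℂ) (Y.Θ k x) := by
  show X.Θ k ((exteriorPower.map k f.lin).baseChange ℂ x) = _
  rw [BC.thetaEquiv_apply, BC.thetaEquiv_apply, BC.theta_naturality]

/-- `ModelAxioms` of the exterior CM-model (toy seat, `Model/Toy/Toy.lean`; no input). -/
theorem tM : (toyModelWith exteriorHodgeData).ModelAxioms := toyModel_modelAxioms

/-- `2 dim A′ = #Idx A′` for a CM product of the exterior model -/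
theorem two_mul_dim_eq_card (F : CMField) {m : ℕ} (Θ' : Fin (m + 1) → CMType F) :
    2 * (toyModelWith exteriorHodgeData).dim ((toyModelWith exteriorHodgeData).cmProd F Θ') =
      Fintype.card ((toyModelWith exteriorHodgeData).cmProd F Θ').Idx := by
  have h1 := Universe.finrank_coh_one_cmProd tM F Θ'
  change Module.finrank ℚ ↥(⋀[ℚ]^1 ((toyModelWith exteriorHodgeData).cmProd F Θ').L) = _ at h1
  rw [exteriorPower.finrank_eq, Nat.choose_one_right] at h1
  rw [Universe.two_mul_dim_cmProd_of_dimProd tM (fact_dimProd _) F Θ', card_Idx, h1]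

/-- `nhol univ = dim A′`: half of the eigen-indices of a CM product are holomorphic -/
theorem nhol_univ_eq_dim (F : CMField) {m : ℕ} (Θ' : Fin (m + 1) → CMType F) :
    ((toyModelWith exteriorHodgeData).cmProd F Θ').nhol Finset.univ =
      (toyModelWith exteriorHodgeData).dim ((toyModelWith exteriorHodgeData).cmProd F Θ') := by
  have h := two_mul_nhol_univ ((toyModelWith exteriorHodgeData).cmProd F Θ')
  rw [← two_mul_dim_eq_card] at h
  omega

/-! ### 4. The witness -/

/-- shorthand for the exterior CM-model (reducible; `toyModel` is the same term behind a `def`) -/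
abbrev TM : Universe := toyModelWith exteriorHodgeData

section Witness

variable {F : CMField} {n m : ℕ} (Ξ : Fin (n + 1 + (m + 1)) → CMType F)
  {pA : TM.Mor (TM.cmProd F Ξ) (TM.cmProd F (blkA Ξ))} {pB : TM.Mor (TM.cmProd F Ξ) (TM.cmProd F (blkB Ξ))}

/-- `1 ⊗ x ≠ 0` for `x ≠ 0` -/
theorem ofRat_ne_zero {X : Obj} {k : ℕ} {x : TM.Coh X k} (hx : x ≠ 0) : (ofRat x : TM.CohC X k) ≠ 0 := fun h =>
  hx (Universe.one_tmul_injective (h.trans (TensorProduct.tmul_zero _ (1 : ℂ)).symm))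

/-- **(a) in positive degree**: the kernel theorem `Universe.boxC_ne_zero_succ`, complexified back. -/
theorem descent_a_succ (hP : TM.IsBlockPair F Ξ pA pB) {ω : TM.Coh (TM.cmProd F (blkB Ξ)) (2 * TM.dim (TM.cmProd F (blkB Ξ)))}
    (hω : ω ≠ 0) {k : ℕ} {e : TM.Coh (TM.cmProd F (blkA Ξ)) (k + 1)}
    (he : TM.cup (TM.cmProd F Ξ) (k + 1) _ (TM.pull pA (k + 1) e) (TM.pull pB _ ω) = 0) : e = 0 := by
  by_contra hne
  apply Universe.boxC_ne_zero_succ Ξ tM toyModel_fact_cupExterior (fact_cupAssoc _)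
    (GysinWitness.fact_dimProd _) hP (ofRat_ne_zero hne) (ofRat_ne_zero hω)
  rw [ofRat_apply, ofRat_apply, Universe.pullC_tmul, Universe.pullC_tmul, Universe.cupC_tmul, mul_one, he,
    TensorProduct.tmul_zero]

/-- **(a) in degree 0**: `H⁰(Y) = ⋀⁰ L = ℚ · 1`, `(r · 1) ∧ z = r · z`, and `p_{Y'}^* ω ≠ 0` (`pullC_top_ne_zero`). -/
theorem descent_a_zero (hP : TM.IsBlockPair F Ξ pA pB) {ω : TM.Coh (TM.cmProd F (blkB Ξ)) (2 * TM.dim (TM.cmProd F (blkB Ξ)))}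
    (hω : ω ≠ 0) {e : TM.Coh (TM.cmProd F (blkA Ξ)) 0}
    (he : TM.cup (TM.cmProd F Ξ) 0 _ (TM.pull pA 0 e) (TM.pull pB _ ω) = 0) : e = 0 := by
  have hB : TM.pull pB _ ω ≠ 0 := by
    intro h0
    apply Universe.pullC_top_ne_zero Ξ tM toyModel_fact_cupExterior (GysinWitness.fact_dimProd _) hP (ofRat_ne_zero hω)
    rw [ofRat_apply, Universe.pullC_tmul, h0, TensorProduct.tmul_zero]
  -- `e = r · 1`
  have hsp : e ∈ Submodule.span ℚ (Set.range (ιMulti ℚ 0 (M := (TM.cmProd F (blkA Ξ)).L))) := by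
    rw [ιMulti_span]; exact Submodule.mem_top
  have hrange : Set.range (ιMulti ℚ 0 (M := (TM.cmProd F (blkA Ξ)).L)) = {ιMulti ℚ 0 ![]} := by
    ext z
    simp only [Set.mem_range, Set.mem_singleton_iff]
    constructor
    · rintro ⟨v, rfl⟩; rw [Subsingleton.elim v ![]]
    · rintro rfl; exact ⟨_, rfl⟩
  rw [hrange, Submodule.mem_span_singleton] at hsp
  obtain ⟨r, rfl⟩ := hsp
  have hpull : TM.pull pA 0 (r • ιMulti ℚ 0 ![]) = r • ιMulti ℚ 0 ![] := by
    show exteriorPower.map 0 pA.lin (r • ιMulti ℚ 0 ![]) = _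
    rw [map_smul, map_apply_ιMulti]
    congr 2
    exact Subsingleton.elim _ _
  -- read `he` in the exterior algebra `⋀ L P`: `(r · 1) * p_{Y'}^* ω = 0`
  have hc : (r • (1 : ExteriorAlgebra ℚ (TM.cmProd F Ξ).L)) * (TM.pull pB _ ω).val = 0 := by
    refine Eq.trans ?_ ((congrArg Subtype.val he).trans (ZeroMemClass.coe_zero _))
    rw [hpull]
    show _ = (wedge ℚ (TM.cmProd F Ξ).L 0 _ (r • ιMulti ℚ 0 ![]) (TM.pull pB _ ω)).val
    rw [wedge_coe, Submodule.coe_smul, ιMulti_apply_coe, ExteriorAlgebra.ιMulti_zero_apply]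
  rw [smul_mul_assoc, one_mul, smul_eq_zero] at hc
  rcases hc with hc | hc
  · rw [hc, zero_smul]
  · exact absurd (ZeroMemClass.coe_eq_zero.mp hc) hB

set_option maxHeartbeats 800000 in
/-- `Θ (p_Y^* x ∪ p_{Y'}^* w) = ⋀ p_{Y,ℂ} (Θ x) ∧ ⋀ p_{Y',ℂ} (Θ w)` -/
theorem theta_boxC (i j : ℕ) (x : TM.CohC (TM.cmProd F (blkA Ξ)) i) (w : TM.CohC (TM.cmProd F (blkB Ξ)) j) :
    (TM.cmProd F Ξ).Θ (i + j) (TM.cupC (TM.cmProd F Ξ) i j (TM.pullC pA i x) (TM.pullC pB j w)) =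
      wedge ℂ (TM.cmProd F Ξ).LC i j (exteriorPower.map i (pA.lin.baseChange ℂ) ((TM.cmProd F (blkA Ξ)).Θ i x))
        (exteriorPower.map j (pB.lin.baseChange ℂ) ((TM.cmProd F (blkB Ξ)).Θ j w)) := by
  rw [← theta_pullC exteriorHodgeData pA i x, ← theta_pullC exteriorHodgeData pB j w]
  exact theta_cupC exteriorHodgeData (TM.cmProd F Ξ) i j _ _

set_option maxHeartbeats 1600000 in
/-- **(b)**: `p_Y^* e ∪ p_{Y'}^* ω ∈ Alg^{p+d'}(P) ⇒ e ∈ Alg^p(Y)` — bigraded bookkeeping `FF ∧ FF ⊆ FF`,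
`GG ∧ GG ⊆ GG`, `FF ∩ GG = 0`, and (a)_ℂ (the heartbeat budget goes into unfolding the model's structure
projections at the CM products). -/
theorem descent_b (hP : TM.IsBlockPair F Ξ pA pB) {ω : TM.Coh (TM.cmProd F (blkB Ξ)) (2 * TM.dim (TM.cmProd F (blkB Ξ)))}
    (hω : ω ≠ 0) (p : ℕ) (e : TM.Coh (TM.cmProd F (blkA Ξ)) (2 * p))
    (he : TM.castCoh (TM.cmProd F Ξ)
      (by omega : 2 * p + 2 * TM.dim (TM.cmProd F (blkB Ξ)) = 2 * (p + TM.dim (TM.cmProd F (blkB Ξ))))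
      (TM.cup (TM.cmProd F Ξ) (2 * p) _ (TM.pull pA (2 * p) e) (TM.pull pB _ ω)) ∈
        TM.alg (TM.cmProd F Ξ) (p + TM.dim (TM.cmProd F (blkB Ξ)))) :
    e ∈ TM.alg (TM.cmProd F (blkA Ξ)) p := by
  rw [castCoh_mem_alg_iff] at he
  -- both memberships in `Θ`-form (`Alg^p = H_ℚ ∩ Θ⁻¹ FF^p`)
  change ofRat _ ∈ (TM.cmProd F Ξ).hodgeF _ _ at he
  rw [Obj.mem_hodgeF] at he
  rw [mem_hodgeClasses_iff]
  change ofRat e ∈ (TM.cmProd F (blkA Ξ)).hodgeF _ _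
  rw [Obj.mem_hodgeF]
  -- complexify the box
  have hbox : (ofRat (TM.cup (TM.cmProd F Ξ) (2 * p) _ (TM.pull pA (2 * p) e) (TM.pull pB _ ω)) :
      TM.CohC (TM.cmProd F Ξ) (2 * p + 2 * TM.dim (TM.cmProd F (blkB Ξ)))) =
        TM.cupC (TM.cmProd F Ξ) (2 * p) _ (TM.pullC pA (2 * p) (ofRat e)) (TM.pullC pB _ (ofRat ω)) := by
    rw [ofRat_apply, ofRat_apply, ofRat_apply, Universe.pullC_tmul, Universe.pullC_tmul, Universe.cupC_tmul,
      mul_one]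
  -- `Θ(1 ⊗ e) = f + g`, `f ∈ FF^p`, `g ∈ GG^p`
  obtain ⟨f, hf, g, hg, hfg⟩ := Submodule.mem_sup.mp
    (show (TM.cmProd F (blkA Ξ)).Θ (2 * p) (ofRat e) ∈
        (TM.cmProd F (blkA Ξ)).FF (2 * p) p ⊔ (TM.cmProd F (blkA Ξ)).GG (2 * p) p by
      rw [Obj.FF_sup_GG]; exact Submodule.mem_top)
  -- the top class of `Y'` has Hodge type `(d', d')`
  have hcard : Fintype.card (TM.cmProd F (blkB Ξ)).Idx = 2 * TM.dim (TM.cmProd F (blkB Ξ)) :=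
    (two_mul_dim_eq_card F (blkB Ξ)).symm
  have hnhol : ((TM.cmProd F (blkB Ξ)).nhol Finset.univ : ℤ) = TM.dim (TM.cmProd F (blkB Ξ)) := by
    exact_mod_cast nhol_univ_eq_dim F (blkB Ξ)
  obtain ⟨hωF, hωG⟩ := top_mem_FF_GG _ hcard ((TM.cmProd F (blkB Ξ)).Θ _ (ofRat ω))
  rw [hnhol] at hωF hωG
  -- images in `P`
  have hAf : exteriorPower.map (2 * p) (pA.lin.baseChange ℂ) f ∈ (TM.cmProd F Ξ).FF (2 * p) p :=
    Obj.FF_map_le pA _ _ ⟨f, hf, rfl⟩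
  have hAg : exteriorPower.map (2 * p) (pA.lin.baseChange ℂ) g ∈ (TM.cmProd F Ξ).GG (2 * p) p :=
    GG_map_le pA _ _ ⟨g, hg, rfl⟩
  have hBF : exteriorPower.map _ (pB.lin.baseChange ℂ) ((TM.cmProd F (blkB Ξ)).Θ _ (ofRat ω)) ∈
      (TM.cmProd F Ξ).FF (2 * TM.dim (TM.cmProd F (blkB Ξ))) (TM.dim (TM.cmProd F (blkB Ξ))) :=
    Obj.FF_map_le pB _ _ ⟨_, hωF, rfl⟩
  have hBG : exteriorPower.map _ (pB.lin.baseChange ℂ) ((TM.cmProd F (blkB Ξ)).Θ _ (ofRat ω)) ∈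
      (TM.cmProd F Ξ).GG (2 * TM.dim (TM.cmProd F (blkB Ξ))) ((TM.dim (TM.cmProd F (blkB Ξ)) : ℤ) + 1) :=
    GG_map_le pB _ _ ⟨_, hωG, rfl⟩
  -- split the hypothesis along `f + g`
  rw [hbox, theta_boxC, ← hfg, map_add, map_add, LinearMap.add_apply, Nat.cast_add] at he
  have hFF := (TM.cmProd F Ξ).wedge_mem_FF _ _ _ _ hAf hBF
  have hGG : wedge ℂ (TM.cmProd F Ξ).LC _ _ (exteriorPower.map (2 * p) (pA.lin.baseChange ℂ) g)
      (exteriorPower.map _ (pB.lin.baseChange ℂ) ((TM.cmProd F (blkB Ξ)).Θ _ (ofRat ω))) ∈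
        (TM.cmProd F Ξ).GG (2 * p + 2 * TM.dim (TM.cmProd F (blkB Ξ))) ((p : ℤ) + TM.dim (TM.cmProd F (blkB Ξ))) := by
    have h := wedge_mem_GG _ _ _ _ _ hAg hBG
    rwa [show (p : ℤ) + ((TM.dim (TM.cmProd F (blkB Ξ)) : ℤ) + 1) - 1 = p + TM.dim (TM.cmProd F (blkB Ξ)) by ring]
      at h
  have hGF : wedge ℂ (TM.cmProd F Ξ).LC _ _ (exteriorPower.map (2 * p) (pA.lin.baseChange ℂ) g)
      (exteriorPower.map _ (pB.lin.baseChange ℂ) ((TM.cmProd F (blkB Ξ)).Θ _ (ofRat ω))) ∈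
        (TM.cmProd F Ξ).FF (2 * p + 2 * TM.dim (TM.cmProd F (blkB Ξ))) ((p : ℤ) + TM.dim (TM.cmProd F (blkB Ξ))) := by
    have h' := Submodule.sub_mem _ he hFF
    rwa [add_sub_cancel_left] at h'
  have hzero : wedge ℂ (TM.cmProd F Ξ).LC _ _ (exteriorPower.map (2 * p) (pA.lin.baseChange ℂ) g)
      (exteriorPower.map _ (pB.lin.baseChange ℂ) ((TM.cmProd F (blkB Ξ)).Θ _ (ofRat ω))) = 0 :=
    Submodule.disjoint_def.mp ((TM.cmProd F Ξ).disjoint_FF_GG _ _) _ hGF hGG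
  -- (a)_ℂ in positive degree (`boxC_ne_zero_succ`) ⇒ `g = 0`; in degree `0`, `GG⁰ = 0`
  have hg0 : g = 0 := by
    rcases Nat.eq_zero_or_pos p with hp | hp
    · subst hp
      have hbot : (TM.cmProd F (blkA Ξ)).GG (2 * 0) ((0 : ℕ) : ℤ) = ⊥ := Obj.GG_eq_bot _ le_rfl
      rw [hbot] at hg
      exact hg
    · obtain ⟨k, hk⟩ : ∃ k, 2 * p = k + 1 := ⟨2 * p - 1, by omega⟩
      by_contra hg0
      have hx0 : ((TM.cmProd F (blkA Ξ)).Θ (2 * p)).symm g ≠ 0 := fun h =>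
        hg0 ((LinearEquiv.map_eq_zero_iff _).mp h)
      have hx1 : TM.castC (TM.cmProd F (blkA Ξ)) hk (((TM.cmProd F (blkA Ξ)).Θ (2 * p)).symm g) ≠ 0 := fun h =>
        hx0 ((LinearEquiv.map_eq_zero_iff _).mp h)
      apply Universe.boxC_ne_zero_succ Ξ tM toyModel_fact_cupExterior (fact_cupAssoc _) (GysinWitness.fact_dimProd _)
        hP hx1 (ofRat_ne_zero hω)
      rw [Universe.pullC_castC, Universe.cupC_castC_left, LinearEquiv.map_eq_zero_iff,
        ← LinearEquiv.map_eq_zero_iff ((TM.cmProd F Ξ).Θ (2 * p + 2 * TM.dim (TM.cmProd F (blkB Ξ)))), theta_boxC,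
        LinearEquiv.apply_symm_apply]
      exact hzero
  rw [← hfg, hg0, add_zero]
  exact hf

end Witness

end GysinWitness

open GysinWitness in
/-- **F7d `Fact_gysinDescent` holds in the exterior CM-model** `toyModelWith exteriorHodgeData` (= `toyModel`). -/
theorem fact_gysinDescent : (toyModelWith exteriorHodgeData).Fact_gysinDescent := fun _F _n _m Ξ _pA _pB hP _ω hω =>
  ⟨fun k _e he => match k with
    | 0 => descent_a_zero Ξ hP hω he
    | _ + 1 => descent_a_succ Ξ hP hω he,
   fun p e he => descent_b Ξ hP hω p e he⟩

/-- **F7d holds in `toyModel`.** -/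
theorem toyModel_fact_gysinDescent : toyModel.Fact_gysinDescent := fact_gysinDescent

/-- **`Fact_dimProd` holds in `toyModel`.** -/
theorem toyModel_fact_dimProd : toyModel.Fact_dimProd := GysinWitness.fact_dimProd exteriorHodgeData

/-- **The generic hypothesis list of the trace-free [QW8] §2.5 cone is jointly satisfiable**: one universe with
`ModelAxioms ∧ N1 ∧ N2 ∧ N3 ∧ N4 ∧ F4 ∧ F5 ∧ F7d ∧ Fact_dimProd` — every generic binder of
`Universe.qw8Sufficiency_of_descentFacts` / `Universe.qw8Milne_of_descentFacts` / `Assembly.COR_CM_of_descentFacts`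
(the remaining binder `RealisationExistsFace` is the route's geometric input, adjudicated elsewhere). -/
theorem descentFacts_consistent :
    ∃ U : Universe, U.ModelAxioms ∧ U.Fact_cupExterior ∧ U.Fact_cup_hodge ∧ U.Fact_pull_H0 ∧ U.Fact_hodge_F0 ∧
      U.Fact_cupAlg ∧ U.Fact_cupAssoc ∧ U.Fact_gysinDescent ∧ U.Fact_dimProd :=
  ⟨toyModel, toyModel_modelAxioms, toyModel_fact_cupExterior, toyModel_fact_cup_hodge, toyModel_fact_pull_H0,
    toyModel_fact_hodge_F0, fact_cupAlg, fact_cupAssoc exteriorHodgeData, fact_gysinDescent,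
    toyModel_fact_dimProd⟩

/-- … hence `Qw8Sufficiency`, `Qw8Milne`, `Qw8ExtProdPos`, `Qw8DualPushPullPos`, `Qw8MilneZero` all HOLD in `toyModel`
(the [QW8] Thm 2.5 steps are not vacuous statements). -/
theorem toyModel_qw8Sufficiency_of_descent : toyModel.Qw8Sufficiency :=
  Universe.qw8Sufficiency_of_descentFacts toyModel_modelAxioms toyModel_fact_cupExterior toyModel_fact_cup_hodge
    toyModel_fact_pull_H0 toyModel_fact_hodge_F0 fact_cupAlg (fact_cupAssoc exteriorHodgeData) fact_gysinDescent
    toyModel_fact_dimProd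

/-- … and likewise `Qw8Milne` ([QW8] Thm 2.5 (iv), the Milne-type product statement) HOLDS in
`toyModel`, by `Universe.qw8Milne_of_descentFacts` applied to the facts proved above. -/
theorem toyModel_qw8Milne_of_descent : toyModel.Qw8Milne :=
  Universe.qw8Milne_of_descentFacts toyModel_modelAxioms toyModel_fact_cupExterior toyModel_fact_cup_hodge
    toyModel_fact_pull_H0 toyModel_fact_hodge_F0 fact_cupAlg (fact_cupAssoc exteriorHodgeData) fact_gysinDescent
    toyModel_fact_dimProd

end HodgeCM.Toy

end
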